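import Summits.KontsevichZagierPeriods.Zeta5Search.LaiSweepShard

/-!
# `κ₃` sweep certificate — shard file 114 of 127 (shards 798–804 of 889)

HONEST FRAMING. Systematic search; no irrationality claim unless certified. This file only checks,
by `decide +kernel`, shards 798–804 of the order-cell sweep of the `κ₃` point `(74, 2180, 444; δ74)`
(engine `LaiSweepEngine`, soundness `LaiSweepJump/Free/Eval/Shard/Kappa3`; a shard is `⟨regime, n,
p, q, p', q', Lo, Up⟩`: `n` cells from `p/q` to `p'/q'` with integer rate sums in `[Lo, Up]`, `K =
128`, `D = 2^40`). It draws NO conclusion: only the capstone `LaiKappa3SweepCert`, which needs all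
127 shard files, does. Kernel cost of this file ≈ 560 cells × 0.3 s.
-/

namespace Summit.KontsevichZagierPeriods.Zeta5Search.Sweep

set_option maxHeartbeats 100000000 in
/-- Shard 798: 80 cells of regime B from `241/272` to `307/346`.
[cite: Lai2024BallRivoal, §4 Lemma 4.3] -/
theorem shard798 :
    Shard.check 128 (2^40)
      ⟨true, 80, 241, 272, 307, 346, 10515964084449, 17570169926851⟩ = true := by
  decide +kernel

set_option maxHeartbeats 100000000 in
/-- Shard 799: 80 cells of regime B from `307/346` to `223/251`.
[cite: Lai2024BallRivoal, §4 Lemma 4.3] -/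
theorem shard799 :
    Shard.check 128 (2^40)
      ⟨true, 80, 307, 346, 223, 251, 9746198361369, 16300282444217⟩ = true := by
  decide +kernel

set_option maxHeartbeats 100000000 in
/-- Shard 800: 80 cells of regime B from `223/251` to `105/118`.
[cite: Lai2024BallRivoal, §4 Lemma 4.3] -/
theorem shard800 :
    Shard.check 128 (2^40)
      ⟨true, 80, 223, 251, 105, 118, 11594216986662, 19411868398239⟩ = true := by
  decide +kernel

set_option maxHeartbeats 100000000 in
/-- Shard 801: 80 cells of regime B from `105/118` to `229/257`.
[cite: Lai2024BallRivoal, §4 Lemma 4.3] -/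
theorem shard801 :
    Shard.check 128 (2^40)
      ⟨true, 80, 105, 118, 229, 257, 10211799278997, 17115371613843⟩ = true := by
  decide +kernel

set_option maxHeartbeats 100000000 in
/-- Shard 802: 80 cells of regime B from `229/257` to `58/65`.
[cite: Lai2024BallRivoal, §4 Lemma 4.3] -/
theorem shard802 :
    Shard.check 128 (2^40)
      ⟨true, 80, 229, 257, 58, 65, 10512387591865, 17637219898211⟩ = true := by
  decide +kernel

set_option maxHeartbeats 100000000 in
/-- Shard 803: 80 cells of regime B from `58/65` to `235/263`.
[cite: Lai2024BallRivoal, §4 Lemma 4.3] -/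
theorem shard803 :
    Shard.check 128 (2^40)
      ⟨true, 80, 58, 65, 235, 263, 10267780653211, 17244510914420⟩ = true := by
  decide +kernel

set_option maxHeartbeats 100000000 in
/-- Shard 804: 80 cells of regime B from `235/263` to `332/371`.
[cite: Lai2024BallRivoal, §4 Lemma 4.3] -/
theorem shard804 :
    Shard.check 128 (2^40)
      ⟨true, 80, 235, 263, 332, 371, 11213314072930, 18852569442621⟩ = true := by
  decide +kernel

/-- The checked shards of this file, in order. [folklore] -/
def shards114 : List (CheckedShard 128 (2^40)) :=
  [⟨_, shard798⟩, ⟨_, shard799⟩, ⟨_, shard800⟩, ⟨_, shard801⟩, ⟨_, shard802⟩,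
    ⟨_, shard803⟩, ⟨_, shard804⟩]

end Summit.KontsevichZagierPeriods.Zeta5Search.Sweep
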